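import Summits.MatrixMultiplication.MatrixMultiplication.Theorems.EdgePencilCalibration
import HarnessLib

/-!
# THE STAR-CONVEXITY DICHOTOMY: under log-star-convexity of the pencil spectrum towards the vertex flattening,
# `TROP(n,2) ⟹ (TetraExcessZero ∧ ω(K₄) ≤ 4) ∨ (¬TetraExcessZero ∧ ω(K₄) ≤ 24/(5 + log_n 2))`

Support kernel for `stmt-MatrixMultiplication-26697` (`TetraExcessZero : ω(K₄) ≤ ω(2,1,2) =: ψ`, route
`TetrahedronCarving`; cut of record `closes (TetraExcessZero) (TetraPlusTwo) : ω = 2`, UNCHANGED; lineage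
`decomp-mm-lens-6`, generation 44). No item is added or changed; no definition is introduced. `TROP(n,e)` is the
tree's hypothesis of `EdgePencilTropicalPair.sixRung_of_trop`: `∀ φ ∈ X₄(F), φ[W_n^{(e)}] ≤ max (φ[D_n]) n⁴`.

THE HYPOTHESIS `hSC` (stated inline, never a definition): *log-star-convexity of `X₄(F)` on the edge pencil with
respect to the vertex-`0` flattening* — for every `φ ∈ X₄(F)` and every `λ ∈ (0,1)` some `φ' ∈ X₄(F)` has
`φ'[W_m^{(e)}] = (e·m²)^λ · φ[W_m^{(e)}]^{1−λ}` for all `1 ≤ e ≤ m` (`e·m² = ζ^{(0)}[W_m^{(e)}]`, the flattening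
rank of the `K₄` graph tensor across vertex `0`). It is the edge-pencil instance of the 4-mode star-convexity of
the graph-tensor spectrum with respect to a one-mode flattening, Wigderson–Zuiddam, Thm. 12.13, as quoted in
Alman–Li–Pratt 2026, Remark 3.2 [AlmanLiPratt2026] (3-mode precedent: Strassen 1988, Thm. 6.5 [Strassen1988]);
it is NOT a tree fact and is carried as an explicit hypothesis of every theorem below.

THE ARGUMENT (§31–§32). Call `φ ∈ X₄` *blind* at base `n` if `φ[W_n^{(2)}] = φ[D_n]` and *high* if
`φ[D_n] > n⁴`. A blind high point `φ` and `hSC` give, for small `λ > 0`, a point `φ'` with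
`φ'[D_n] = n^{2λ} φ[D_n]^{1−λ} < φ'[W_n^{(2)}] = (2n²)^λ φ[D_n]^{1−λ}` and `φ'[W_n^{(2)}] > n⁴`
(`exists_exponent_interpolate_gt`: `λ < log(φ[D_n]/n⁴) / (2 log(φ[D_n]/(2n²)))` suffices) — a SEPARATING point,
so `TROP(n,2)` fails (`exists_separating_of_blind_high`). Contrapositively, under `TROP(n,2)` every blind point
has `φ[D_n] ≤ n⁴` (`spectrum_diamond_le_of_trop_two_of_blind`). The leaf `ω(K₄) ≤ ψ` is equivalent to the
existence of a blind `T(K₄)_n`-MAXIMAL point (`EdgePencilBlindMaximal.excessZero_iff_exists_blind_maximal`),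
whose diamond value is `n^{ω(K₄)}`; hence `TROP(n,2) ∧ leaf ⟹ ω(K₄) ≤ 4`
(`omegaTetra_le_four_of_excessZero_of_trop_two`), and with the calibration
(`EdgePencilCalibration.tetraExcessZero_or_omegaTetra_le_of_trop_two`) the DICHOTOMY over `ℂ`
(`trop_two_dichotomy`, `n ≥ 3`): one base of tropical domination forces EITHER the flat world
`TetraExcessZero ∧ ω(K₄) ≤ 4` OR the negative world `¬TetraExcessZero ∧ ω(K₄) ≤ 24/(5 + log_n 2)`. In
particular, in any world with `ω(K₄) > 4` the leaf FORBIDS `TROP(n,2)` at every base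
(`not_trop_two_of_excessZero_of_four_lt`): modulo `hSC`, one-base tropical domination is an upper-side route
to the leaf only through `ω(K₄) = 4`.

References: Alman–Li–Pratt 2026, Remark 3.2 and Prop. 1.1 (arXiv:2604.01386) [AlmanLiPratt2026]; Strassen 1988,
Thm. 6.5 [Strassen1988]; Christandl–Vrana–Zuiddam 2023, §1 [ChristandlVranaZuiddam2023]; Zuiddam 2018, §2.3
[Zuiddam2018]. No `sorry`, no new axiom, no instance, no notation, no definition.
-/

noncomputable section

set_option linter.dupNamespace false

open Finset Literature.Computability.AlgebraicComplexity
open Summit.MatrixMultiplication.MatrixMultiplication.Theorems.TetrahedronTensor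
open Summit.MatrixMultiplication.MatrixMultiplication.Theorems.TetraDiagonal
open Summit.MatrixMultiplication.MatrixMultiplication.Theses.TetrahedronCarving

namespace Summit.MatrixMultiplication.MatrixMultiplication.Theorems.EdgePencil

/-! ## §31 The separating interpolant -/

section Interpolant

/-- **Arithmetic core**: if `0 < N < D` and `0 < c`, some `λ ∈ (0,1)` has `c^λ · D^{1−λ} > N`
(take `λ = 1/2` if `D ≤ c`, else `λ = min (1/2, log(D/N)/(2 log(D/c)))`). [cite: Strassen1988, Thm. 6.5] -/
theorem exists_exponent_interpolate_gt {c D N : ℝ} (hc : 0 < c) (hN : 0 < N) (hD : N < D) :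
    ∃ l : ℝ, 0 < l ∧ l < 1 ∧ N < c ^ l * D ^ (1 - l) := by
  have hDpos : 0 < D := lt_trans hN hD
  have hL : 0 < Real.log D - Real.log N := by linarith [Real.log_lt_log hN hD]
  -- it suffices to find `l ∈ (0,1)` with `l · (log D − log c) < log D − log N`
  suffices h : ∃ l : ℝ, 0 < l ∧ l < 1 ∧ l * (Real.log D - Real.log c) < Real.log D - Real.log N by
    obtain ⟨l, hl0, hl1, hl⟩ := h
    refine ⟨l, hl0, hl1, ?_⟩
    rw [Real.rpow_def_of_pos hc, Real.rpow_def_of_pos hDpos, ← Real.exp_add, ← Real.exp_log hN,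
      Real.exp_lt_exp]
    nlinarith
  by_cases ha : Real.log D - Real.log c ≤ 0
  · exact ⟨1 / 2, by norm_num, by norm_num, by nlinarith⟩
  · rw [not_le] at ha
    refine ⟨min (1 / 2) ((Real.log D - Real.log N) / (2 * (Real.log D - Real.log c))),
      lt_min (by norm_num) (div_pos hL (by positivity)),
      lt_of_le_of_lt (min_le_left _ _) (by norm_num), ?_⟩
    calc min (1 / 2) ((Real.log D - Real.log N) / (2 * (Real.log D - Real.log c)))
          * (Real.log D - Real.log c)
        ≤ (Real.log D - Real.log N) / (2 * (Real.log D - Real.log c)) * (Real.log D - Real.log c) :=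
          mul_le_mul_of_nonneg_right (min_le_right _ _) ha.le
      _ = (Real.log D - Real.log N) / 2 := by field_simp
      _ < Real.log D - Real.log N := by linarith

variable (F : Type) [Field F]

/-- **THE SEPARATING INTERPOLANT**: under log-star-convexity of the pencil spectrum towards the vertex-`0`
flattening (`hSC`), a point `φ ∈ X₄(F)` that is BLIND at base `n` (`φ[W_n^{(2)}] = φ[D_n]`) and HIGH
(`φ[D_n] > n⁴`) yields a SEPARATING point `φ'` (`φ'[W_n^{(2)}] > max (φ'[D_n]) n⁴`).
[cite: AlmanLiPratt2026, Remark 3.2] -/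
theorem exists_separating_of_blind_high
    (hSC : ∀ φ ∈ DTensorClass.asymptoticSpectrumDTensors F 2, ∀ l : ℝ, 0 < l → l < 1 →
      ∃ φ' ∈ DTensorClass.asymptoticSpectrumDTensors F 2, ∀ m e : ℕ, 1 ≤ e → e ≤ m →
        φ' (DTensorClass.mk (sixTetra F m e)) =
          ((e : ℝ) * (m : ℝ) ^ 2) ^ l * (φ (DTensorClass.mk (sixTetra F m e))) ^ (1 - l))
    {n : ℕ} (hn : 2 ≤ n) {φ : DTensorClass F 4 → ℝ} (hφ : φ ∈ DTensorClass.asymptoticSpectrumDTensors F 2)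
    (hbl : φ (DTensorClass.mk (sixTetra F n 2)) = φ (DTensorClass.mk (sixTetra F n 1)))
    (hhigh : (n : ℝ) ^ 4 < φ (DTensorClass.mk (sixTetra F n 1))) :
    ∃ φ' ∈ DTensorClass.asymptoticSpectrumDTensors F 2,
      max (φ' (DTensorClass.mk (sixTetra F n 1))) ((n : ℝ) ^ 4) < φ' (DTensorClass.mk (sixTetra F n 2)) := by
  have hn0' : (0 : ℝ) < n := by exact_mod_cast (show 0 < n by omega)
  have hN : (0 : ℝ) < (n : ℝ) ^ 4 := by positivity
  have hc : (0 : ℝ) < 2 * (n : ℝ) ^ 2 := by positivity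
  have hDpos : 0 < φ (DTensorClass.mk (sixTetra F n 1)) := lt_trans hN hhigh
  obtain ⟨l, hl0, hl1, hlt⟩ := exists_exponent_interpolate_gt hc hN hhigh
  obtain ⟨φ', hφ', hφ'eq⟩ := hSC φ hφ l hl0 hl1
  refine ⟨φ', hφ', ?_⟩
  have h2 := hφ'eq n 2 (by norm_num) hn
  have h1 := hφ'eq n 1 le_rfl (by omega)
  rw [hbl] at h2
  push_cast at h1 h2
  rw [one_mul] at h1
  have hDl : 0 < (φ (DTensorClass.mk (sixTetra F n 1))) ^ (1 - l) := Real.rpow_pos_of_pos hDpos _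
  rw [max_lt_iff, h1, h2]
  refine ⟨mul_lt_mul_of_pos_right (Real.rpow_lt_rpow (by positivity) (by nlinarith) hl0) hDl, hlt⟩

/-- **Under `TROP(n,2)`, every blind point is low**: `φ[W_n^{(2)}] = φ[D_n] ⟹ φ[D_n] ≤ n⁴` (`n ≥ 2`, modulo
`hSC`). [cite: AlmanLiPratt2026, Remark 3.2] -/
theorem spectrum_diamond_le_of_trop_two_of_blind
    (hSC : ∀ φ ∈ DTensorClass.asymptoticSpectrumDTensors F 2, ∀ l : ℝ, 0 < l → l < 1 →
      ∃ φ' ∈ DTensorClass.asymptoticSpectrumDTensors F 2, ∀ m e : ℕ, 1 ≤ e → e ≤ m →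
        φ' (DTensorClass.mk (sixTetra F m e)) =
          ((e : ℝ) * (m : ℝ) ^ 2) ^ l * (φ (DTensorClass.mk (sixTetra F m e))) ^ (1 - l))
    {n : ℕ} (hn : 2 ≤ n)
    (hT : ∀ φ ∈ DTensorClass.asymptoticSpectrumDTensors F 2,
      φ (DTensorClass.mk (sixTetra F n 2)) ≤ max (φ (DTensorClass.mk (sixTetra F n 1))) ((n : ℝ) ^ 4))
    {φ : DTensorClass F 4 → ℝ} (hφ : φ ∈ DTensorClass.asymptoticSpectrumDTensors F 2)
    (hbl : φ (DTensorClass.mk (sixTetra F n 2)) = φ (DTensorClass.mk (sixTetra F n 1))) :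
    φ (DTensorClass.mk (sixTetra F n 1)) ≤ (n : ℝ) ^ 4 := by
  by_contra h
  rw [not_le] at h
  obtain ⟨φ', hφ', hlt⟩ := exists_separating_of_blind_high F hSC hn hφ hbl h
  exact absurd (hT φ' hφ') (not_le.2 hlt)

/-- The same with blindness in pair form `φ[P_2] = 1`. [cite: AlmanLiPratt2026, Remark 3.2] -/
theorem spectrum_diamond_le_of_trop_two_of_pair_eq_one
    (hSC : ∀ φ ∈ DTensorClass.asymptoticSpectrumDTensors F 2, ∀ l : ℝ, 0 < l → l < 1 →
      ∃ φ' ∈ DTensorClass.asymptoticSpectrumDTensors F 2, ∀ m e : ℕ, 1 ≤ e → e ≤ m →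
        φ' (DTensorClass.mk (sixTetra F m e)) =
          ((e : ℝ) * (m : ℝ) ^ 2) ^ l * (φ (DTensorClass.mk (sixTetra F m e))) ^ (1 - l))
    {n : ℕ} (hn : 2 ≤ n)
    (hT : ∀ φ ∈ DTensorClass.asymptoticSpectrumDTensors F 2,
      φ (DTensorClass.mk (sixTetra F n 2)) ≤ max (φ (DTensorClass.mk (sixTetra F n 1))) ((n : ℝ) ^ 4))
    {φ : DTensorClass F 4 → ℝ} (hφ : φ ∈ DTensorClass.asymptoticSpectrumDTensors F 2)
    (hP : φ (DTensorClass.mk (fun a : Fin 4 → Fin 2 => (ind (a 0 = a 1) : F))) = 1) :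
    φ (DTensorClass.mk (sixTetra F n 1)) ≤ (n : ℝ) ^ 4 :=
  spectrum_diamond_le_of_trop_two_of_blind F hSC hn hT hφ
    ((blind_iff_pair_eq_one F (by omega) hn hφ).2 hP)

end Interpolant

/-! ## §32 The dichotomy -/

section Dichotomy

variable (F : Type) [Field F]

/-- **`TROP(n,2) ∧ leaf ⟹ ω(K₄) ≤ 4`** (`n ≥ 2`, modulo `hSC`): the leaf supplies a blind `T(K₄)_n`-maximal point,
whose diamond value `n^{ω(K₄)}` is then at most `n⁴`. [cite: AlmanLiPratt2026, Remark 3.2] -/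
theorem omegaTetra_le_four_of_excessZero_of_trop_two
    (hSC : ∀ φ ∈ DTensorClass.asymptoticSpectrumDTensors F 2, ∀ l : ℝ, 0 < l → l < 1 →
      ∃ φ' ∈ DTensorClass.asymptoticSpectrumDTensors F 2, ∀ m e : ℕ, 1 ≤ e → e ≤ m →
        φ' (DTensorClass.mk (sixTetra F m e)) =
          ((e : ℝ) * (m : ℝ) ^ 2) ^ l * (φ (DTensorClass.mk (sixTetra F m e))) ^ (1 - l))
    {n : ℕ} (hn : 2 ≤ n)
    (hT : ∀ φ ∈ DTensorClass.asymptoticSpectrumDTensors F 2,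
      φ (DTensorClass.mk (sixTetra F n 2)) ≤ max (φ (DTensorClass.mk (sixTetra F n 1))) ((n : ℝ) ^ 4))
    (hA : omegaTetra F ≤ omegaRect F 2 1 2) : omegaTetra F ≤ 4 := by
  obtain ⟨φ, hφ, hmax, hblind⟩ := (excessZero_iff_exists_blind_maximal F hn).1 hA
  have hn1' : (1 : ℝ) < n := by exact_mod_cast (show 1 < n by omega)
  have hTn : φ (DTensorClass.mk (tetra F n)) = (n : ℝ) ^ omegaTetra F := by
    rw [hmax, rpow_omegaTetra_eq_asympRank F hn]
  -- blindness at thickness `2`: `φ[D_n] ≤ φ[W_n^{(2)}] ≤ φ[W_n^{(n)}] = φ[T(K₄)_n] = φ[D_n]`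
  have hW2le : φ (DTensorClass.mk (sixTetra F n 2)) ≤ φ (DTensorClass.mk (tetra F n)) := by
    have h := (DTensorClass.mem_asymptoticSpectrumDTensors_iff.1 hφ).mono
      (mk_sixTetra_mono (F := F) (n := n) hn)
    rwa [sixTetra_of_le le_rfl] at h
  have hbl2 : φ (DTensorClass.mk (sixTetra F n 2)) = φ (DTensorClass.mk (sixTetra F n 1)) :=
    le_antisymm (by rw [← hblind]; exact hW2le) (spectrum_diamond_le_sixTetra (F := F) (by norm_num) hφ)
  have hD := spectrum_diamond_le_of_trop_two_of_blind F hSC hn hT hφ hbl2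
  rw [← hblind, hTn] at hD
  have h4 : (n : ℝ) ^ omegaTetra F ≤ (n : ℝ) ^ (4 : ℝ) := by
    rw [show (4 : ℝ) = ((4 : ℕ) : ℝ) by norm_num, Real.rpow_natCast]
    exact hD
  exact (Real.rpow_le_rpow_left_iff hn1').1 h4

/-- **In a world with `ω(K₄) > 4` the leaf FORBIDS one-base tropical domination** (`n ≥ 2`, modulo `hSC`).
[cite: AlmanLiPratt2026, Remark 3.2] -/
theorem not_trop_two_of_excessZero_of_four_lt
    (hSC : ∀ φ ∈ DTensorClass.asymptoticSpectrumDTensors F 2, ∀ l : ℝ, 0 < l → l < 1 →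
      ∃ φ' ∈ DTensorClass.asymptoticSpectrumDTensors F 2, ∀ m e : ℕ, 1 ≤ e → e ≤ m →
        φ' (DTensorClass.mk (sixTetra F m e)) =
          ((e : ℝ) * (m : ℝ) ^ 2) ^ l * (φ (DTensorClass.mk (sixTetra F m e))) ^ (1 - l))
    {n : ℕ} (hn : 2 ≤ n) (hA : omegaTetra F ≤ omegaRect F 2 1 2) (h4 : 4 < omegaTetra F) :
    ¬ ∀ φ ∈ DTensorClass.asymptoticSpectrumDTensors F 2,
      φ (DTensorClass.mk (sixTetra F n 2)) ≤ max (φ (DTensorClass.mk (sixTetra F n 1))) ((n : ℝ) ^ 4) :=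
  fun hT => absurd (omegaTetra_le_four_of_excessZero_of_trop_two F hSC hn hT hA) (not_le.2 h4)

/-- **Every blind point of `X₄` is low under `TROP(n,2)`, uniformly**: the *blind height*
`sup {log_n φ[D_n] : φ blind}` is at most `4` (it is at least `4`: the `{01}|{23}` flattening).
[cite: AlmanLiPratt2026, Remark 3.2] -/
theorem logb_spectrum_diamond_le_four_of_trop_two_of_blind
    (hSC : ∀ φ ∈ DTensorClass.asymptoticSpectrumDTensors F 2, ∀ l : ℝ, 0 < l → l < 1 →
      ∃ φ' ∈ DTensorClass.asymptoticSpectrumDTensors F 2, ∀ m e : ℕ, 1 ≤ e → e ≤ m →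
        φ' (DTensorClass.mk (sixTetra F m e)) =
          ((e : ℝ) * (m : ℝ) ^ 2) ^ l * (φ (DTensorClass.mk (sixTetra F m e))) ^ (1 - l))
    {n : ℕ} (hn : 2 ≤ n)
    (hT : ∀ φ ∈ DTensorClass.asymptoticSpectrumDTensors F 2,
      φ (DTensorClass.mk (sixTetra F n 2)) ≤ max (φ (DTensorClass.mk (sixTetra F n 1))) ((n : ℝ) ^ 4))
    {φ : DTensorClass F 4 → ℝ} (hφ : φ ∈ DTensorClass.asymptoticSpectrumDTensors F 2)
    (hbl : φ (DTensorClass.mk (sixTetra F n 2)) = φ (DTensorClass.mk (sixTetra F n 1))) :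
    Real.logb n (φ (DTensorClass.mk (sixTetra F n 1))) ≤ 4 := by
  have hn1' : (1 : ℝ) < n := by exact_mod_cast (show 1 < n by omega)
  have hD1 : 1 ≤ φ (DTensorClass.mk (sixTetra F n 1)) :=
    one_le_spectrum_sixTetra (F := F) (by omega) le_rfl hφ
  have hD := spectrum_diamond_le_of_trop_two_of_blind F hSC hn hT hφ hbl
  calc Real.logb n (φ (DTensorClass.mk (sixTetra F n 1)))
      ≤ Real.logb n ((n : ℝ) ^ 4) := Real.logb_le_logb_of_le hn1' (by linarith) hD
    _ = 4 := by
        rw [show ((n : ℝ) ^ 4) = (n : ℝ) ^ (4 : ℝ) by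
          rw [show (4 : ℝ) = ((4 : ℕ) : ℝ) by norm_num, Real.rpow_natCast]]
        exact Real.logb_rpow (by linarith) hn1'.ne'

/-- **THE DICHOTOMY over `ℂ`** (`n ≥ 3`, modulo `hSC`): one base of tropical domination `TROP(n,2)` forces
EITHER the flat world `TetraExcessZero ∧ ω(K₄) ≤ 4` OR the negative world
`¬TetraExcessZero ∧ ω(K₄) ≤ 24/(5 + log_n 2)`. [cite: AlmanLiPratt2026, Remark 3.2] -/
theorem trop_two_dichotomy
    (hSC : ∀ φ ∈ DTensorClass.asymptoticSpectrumDTensors ℂ 2, ∀ l : ℝ, 0 < l → l < 1 →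
      ∃ φ' ∈ DTensorClass.asymptoticSpectrumDTensors ℂ 2, ∀ m e : ℕ, 1 ≤ e → e ≤ m →
        φ' (DTensorClass.mk (sixTetra ℂ m e)) =
          ((e : ℝ) * (m : ℝ) ^ 2) ^ l * (φ (DTensorClass.mk (sixTetra ℂ m e))) ^ (1 - l))
    {n : ℕ} (hn : 3 ≤ n)
    (hT : ∀ φ ∈ DTensorClass.asymptoticSpectrumDTensors ℂ 2,
      φ (DTensorClass.mk (sixTetra ℂ n 2)) ≤ max (φ (DTensorClass.mk (sixTetra ℂ n 1))) ((n : ℝ) ^ 4)) :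
    (TetraExcessZero ∧ omegaTetra ℂ ≤ 4) ∨
      (¬ TetraExcessZero ∧ omegaTetra ℂ ≤ 24 / (5 + Real.logb n 2)) := by
  by_cases hA : TetraExcessZero
  · exact Or.inl ⟨hA, omegaTetra_le_four_of_excessZero_of_trop_two ℂ hSC (by omega) hT hA⟩
  · rcases tetraExcessZero_or_omegaTetra_le_of_trop_two hn hT with h | h
    · exact absurd h hA
    · exact Or.inr ⟨hA, h⟩

/-- **Corollary**: modulo `hSC`, `TROP(n,2)` at one base `n ≥ 3` bounds the tetrahedron exponent by
`max 4 (24/(5 + log_n 2)) = 24/(5 + log_n 2)` UNCONDITIONALLY in the leaf (`< 4.8`; `n = 3`: `4.2619…`).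
[cite: AlmanLiPratt2026, Remark 3.2] -/
theorem omegaTetra_le_of_trop_two
    (hSC : ∀ φ ∈ DTensorClass.asymptoticSpectrumDTensors ℂ 2, ∀ l : ℝ, 0 < l → l < 1 →
      ∃ φ' ∈ DTensorClass.asymptoticSpectrumDTensors ℂ 2, ∀ m e : ℕ, 1 ≤ e → e ≤ m →
        φ' (DTensorClass.mk (sixTetra ℂ m e)) =
          ((e : ℝ) * (m : ℝ) ^ 2) ^ l * (φ (DTensorClass.mk (sixTetra ℂ m e))) ^ (1 - l))
    {n : ℕ} (hn : 3 ≤ n)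
    (hT : ∀ φ ∈ DTensorClass.asymptoticSpectrumDTensors ℂ 2,
      φ (DTensorClass.mk (sixTetra ℂ n 2)) ≤ max (φ (DTensorClass.mk (sixTetra ℂ n 1))) ((n : ℝ) ^ 4)) :
    omegaTetra ℂ ≤ 24 / (5 + Real.logb n 2) := by
  have hn1' : (1 : ℝ) < n := by exact_mod_cast (show 1 < n by omega)
  have hδ1 : Real.logb n 2 ≤ 1 := by
    rw [← Real.logb_self_eq_one hn1']
    exact Real.logb_le_logb_of_le hn1' two_pos (by exact_mod_cast (show 2 ≤ n by omega))
  have hδ0 : 0 ≤ Real.logb n 2 := Real.logb_nonneg hn1' (by norm_num)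
  have hcap : (4 : ℝ) ≤ 24 / (5 + Real.logb n 2) := by
    rw [le_div_iff₀ (by linarith)]
    linarith
  rcases trop_two_dichotomy hSC hn hT with ⟨-, h⟩ | ⟨-, h⟩
  · exact le_trans h hcap
  · exact h

end Dichotomy

end Summit.MatrixMultiplication.MatrixMultiplication.Theorems.EdgePencil

end
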